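import Mathlib
import HarnessLib
import Literature.Analysis.FluidPDE.ClassicalSolution
import Literature.Analysis.FluidPDE.LerayHopf
import Literature.Analysis.FluidPDE.SelfSimilar
import Literature.Analysis.FluidPDE.LocalTypeI
import Literature.Analysis.FluidPDE.AxisymmetricEuler
import Literature.Analysis.FluidPDE.AxisymmetricVorticityTransport
import Literature.Analysis.FluidPDE.MildSolutionIsometryCovariance
import Literature.Analysis.FluidPDE.AncientAxisymmetricTypeILiouville
import Literature.Analysis.FluidPDE.TypeIAncientMild
import Summits.NavierStokesRegularity.NavierStokesRegularity.Theorems.LocalVelCompTubeDoorLocalPointZoomVelSlices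
import Summits.NavierStokesRegularity.NavierStokesRegularity.Theorems.PlaneStrainDoorZoomSpaceTimeDecay
import Summits.NavierStokesRegularity.NavierStokesRegularity.Theorems.PoloidalWindowDoorPoloidalWindowRigidityWindow
import Summits.NavierStokesRegularity.NavierStokesRegularity.Theorems.AdaptedFrequencyTangentFlowTransferAncientPressure
import Summits.NavierStokesRegularity.NavierStokesRegularity.Theorems.QuantisedSymmetryPolyhedralDssProfileExistsStubAncientMildOfClassicalTypeI
import Summits.NavierStokesRegularity.NavierStokesRegularity.Theorems.ZoomReturnDoorDefs
import Summits.NavierStokesRegularity.NavierStokesRegularity.Theorems.ZoomReturnDoorWindowLimit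
import Summits.NavierStokesRegularity.NavierStokesRegularity.Theorems.ZoomReturnDoorRemovableFactors
import Summits.NavierStokesRegularity.NavierStokesRegularity.Theorems.ZoomReturnDoorLimit
import Summits.NavierStokesRegularity.NavierStokesRegularity.Theorems.ZoomReturnDoorGlue
import Summits.NavierStokesRegularity.NavierStokesRegularity.Theorems.ZoomReturnDoorExtraction
import Summits.NavierStokesRegularity.NavierStokesRegularity.Theorems.ZoomReturnDoorClassicalLimit

/-!
# StableStrataDoorDefs — S26 «StableStrataDoor» (ε-STABLE STRATA: the open-neighbourhood principle K-stab(Φ,𝔖) and the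
ε-AXISYMMETRIC Type-I door, uniform in the axis), part 1/6: observables, texts, door logic (§0–§2)

§0 the observables (`axiDefect` = finite-rotation equivariance defect about the axis `A e₃`, the physical / profile window
fields `physWindowField` / `profileWindowField`, `AxiDefectEventuallySmall`, `HasSmallAxiDefectOn`), §1 the texts of S26
(K1-axi `LocalPointZoomAxiDefect`, residue R-axi `AxiResidue`, K-axi `AxiStability`, door T-axi `TargetEpsAxisymAt` /
`TargetEpsAxisym`, `AssemblyAxi`) and §2 the proved door logic (`eq_zero_of_decay_nonpos`, `targetEpsAxisymAt_of_residue`,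
`assemblyAxi_holds`: K1-axi → K-axi → T-axi).

Door family of LADDER-NS N0 (local Type-I window doors S20–S26); THEOREMS-ONLY landing of the nsreg-p1 design
`run/shared/lean/pub/ns-regularity-ideate/ns-regularity-ideate-p1/r25/Sketch26.lean` (ROUND-25.md; sha16 bf87a99673b3e6ef,
farm rc 0 / 0 sorry), split by section into `StableStrataDoor{Defs, WindowLimit, AxiStability, Schema, Instances, Uniform}`,
texts verbatim, namespace = file stem.  No route, no items (DIRECTOR-NS standing #32 (2); landing lane ns-door-S23-p1).
WHAT THIS IS NOT: not NS regularity (Clay (A)) and not a dent in `NoTypeII` (stmt-0056) — every statement lives INSIDE the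
Type-I class; not the swirl hard cores (no Type-I-free statement); not the Type-I Liouville conjecture — only window-open
neighbourhoods of strata where it is already a theorem; `ε` comes from compactness and is NOT explicit.
-/

noncomputable section

set_option linter.dupNamespace false

namespace Summit.NavierStokesRegularity.NavierStokesRegularity.Theorems.StableStrataDoorDefs

open MeasureTheory Set Function Filter Topology TopologicalSpace Metric
open scoped RealInnerProductSpace NNReal ENNReal Topology Pointwise
open Literature.Analysis Literature.Analysis.FluidPDE
open Summit.NavierStokesRegularity.NavierStokesRegularity.Theorems.PoloidalWindowDoorPoloidalWindowRigidityWindow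
open Summit.NavierStokesRegularity.NavierStokesRegularity.Theorems.ZoomReturnDoorDefs
open Summit.NavierStokesRegularity.NavierStokesRegularity.Theorems.ZoomReturnDoorWindowLimit
open Summit.NavierStokesRegularity.NavierStokesRegularity.Theorems.ZoomReturnDoorRemovableFactors
open Summit.NavierStokesRegularity.NavierStokesRegularity.Theorems.ZoomReturnDoorGlue
open Summit.NavierStokesRegularity.NavierStokesRegularity.Theorems.ZoomReturnDoorExtraction
open Summit.NavierStokesRegularity.NavierStokesRegularity.Theorems.ZoomReturnDoorClassicalLimit

/-! ## §0 The observable: the finite-rotation equivariance defect about the axis `A e₃` -/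

/-- The **axisymmetry defect** of a slice field `F` about the axis `A e₃` (`A` a linear isometry of `ℝ³`), at rotation
angle `θ` and window point `ζ`: with the conjugated field `G = A⁻¹ ∘ F ∘ A`, `‖R_θ (G ζ) − G (R_θ ζ)‖`.  `F` is equivariant
under all rotations about `A e₃` iff `IsAxisymmetric G` iff the defect vanishes identically. -/
def axiDefect (A : EuclideanSpace ℝ (Fin 3) ≃ₗᵢ[ℝ] EuclideanSpace ℝ (Fin 3))
    (F : EuclideanSpace ℝ (Fin 3) → EuclideanSpace ℝ (Fin 3)) (θ : ℝ) (ζ : EuclideanSpace ℝ (Fin 3)) : ℝ :=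
  ‖rotZ θ (A.symm (F (A ζ))) - A.symm (F (A (rotZ θ ζ)))‖

/-- The scale-normalised velocity of `u` around the candidate singular point `(x₀, T)` read at time `t < T` in similarity
coordinates `y`: `√(T−t) · u(t, x₀ + √(T−t) y)` (S23/S25's window field, `twoTimeDefect` with `μ = 1`, one time). -/
def physWindowField (T : ℝ) (x₀ : EuclideanSpace ℝ (Fin 3)) (u : ℝ → EuclideanSpace ℝ (Fin 3) → EuclideanSpace ℝ (Fin 3))
    (t : ℝ) (y : EuclideanSpace ℝ (Fin 3)) : EuclideanSpace ℝ (Fin 3) :=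
  Real.sqrt (T - t) • u t (x₀ + Real.sqrt (T - t) • y)

/-- **The axisymmetry defect about `x₀ + ℝ·A e₃` is EVENTUALLY `ε`-SMALL on the window `U`:** for `t` close to `T⁻` and
EVERY angle `θ`, `∫_U ‖R_θ G_t(ζ) − G_t(R_θ ζ)‖ dζ ≤ ε`, `G_t = A⁻¹ ∘ (√(T−t) u(t, x₀ + √(T−t)·)) ∘ A`. -/
def AxiDefectEventuallySmall (T : ℝ) (x₀ : EuclideanSpace ℝ (Fin 3))
    (u : ℝ → EuclideanSpace ℝ (Fin 3) → EuclideanSpace ℝ (Fin 3)) (A : EuclideanSpace ℝ (Fin 3) ≃ₗᵢ[ℝ] EuclideanSpace ℝ (Fin 3))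
    (U : Set (EuclideanSpace ℝ (Fin 3))) (ε : ℝ) : Prop :=
  ∀ᶠ t in nhdsWithin T (Set.Iio T), ∀ θ : ℝ,
    ∫⁻ ζ in U, ENNReal.ofReal (axiDefect A (physWindowField T x₀ u t) θ ζ) ≤ ENNReal.ofReal ε

/-- The profile-side window field at profile time `s < 0`: the window sits at similarity scale `σ = √(−s)/√ν` and the
field is `(σν) · v(s, σ y)` (S25's normalisation, `profileDefect` with `μ = 1`, one time). -/
def profileWindowField (ν : ℝ) (v : ℝ → EuclideanSpace ℝ (Fin 3) → EuclideanSpace ℝ (Fin 3)) (s : ℝ)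
    (y : EuclideanSpace ℝ (Fin 3)) : EuclideanSpace ℝ (Fin 3) :=
  (Real.sqrt (-s) / Real.sqrt ν * ν) • v s ((Real.sqrt (-s) / Real.sqrt ν) • y)

/-- **`ε`-small axisymmetry defect of the profile about `A e₃` on the window `U` at EVERY profile time and angle.** -/
def HasSmallAxiDefectOn (ν : ℝ) (A : EuclideanSpace ℝ (Fin 3) ≃ₗᵢ[ℝ] EuclideanSpace ℝ (Fin 3)) (ε : ℝ)
    (U : Set (EuclideanSpace ℝ (Fin 3))) (v : ℝ → EuclideanSpace ℝ (Fin 3) → EuclideanSpace ℝ (Fin 3)) : Prop :=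
  ∀ s < 0, ∀ θ : ℝ, ∫⁻ ζ in U, ENNReal.ofReal (axiDefect A (profileWindowField ν v s) θ ζ) ≤ ENNReal.ofReal ε

/-! ## §1 The texts of S26 (instance ε-axisymmetric) -/

/-- crux (rank 3) · K1-axi · THE AXISYMMETRY-DEFECT ZOOM (PROVED below, `localPointZoomAxiDefect_holds`): space–time local
Type I at `(x₀, T)` + backward unboundedness ⇒ ONE door-class profile with decay `M/ν`, backward-singular at the apex, on
which every EVENTUALLY `ε`-SMALL axisymmetry defect (any axis `A e₃`, any window `U`) is `ε`-small at every profile time. -/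
def LocalPointZoomAxiDefect : Prop :=
  ∀ (ν T : ℝ), 0 < ν → 0 < T → ∀ (u : ℝ → EuclideanSpace ℝ (Fin 3) → EuclideanSpace ℝ (Fin 3))
    (p : ℝ → EuclideanSpace ℝ (Fin 3) → ℝ), IsClassicalNSSolutionOn (Set.Ico 0 T) ν 0 u p →
    IsLerayHopfOn T ν 0 (u 0) u → HasRapidSpatialDecay (u 0) →
    ∀ (x₀ : EuclideanSpace ℝ (Fin 3)) (ρ M : ℝ), 0 < ρ →
    (∀ t ∈ Set.Ico 0 T, T - ρ ^ 2 < t → ∀ x ∈ Metric.ball x₀ ρ, ‖u t x‖ * (‖x - x₀‖ + Real.sqrt (ν * (T - t))) ≤ M) →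
    ¬ IsBackwardBoundedAt u T x₀ →
    ∃ (C : ℝ) (v : ℝ → EuclideanSpace ℝ (Fin 3) → EuclideanSpace ℝ (Fin 3)), IsDoorProfile C v ∧
      HasTypeIDecay (M / ν) v ∧ IsBackwardSingularPoint v 0 ∧
      ∀ (A : EuclideanSpace ℝ (Fin 3) ≃ₗᵢ[ℝ] EuclideanSpace ℝ (Fin 3)) (U : Set (EuclideanSpace ℝ (Fin 3))) (ε : ℝ),
        AxiDefectEventuallySmall T x₀ u A U ε → HasSmallAxiDefectOn ν A ε U v

/-- An `ε`-STABLE AXISYMMETRIC STRATUM at viscosity `ν`, decay `D`, axis `A e₃` (the residue R-axi): for every bounded open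
nonempty window `U` some `ε > 0` makes every classical Type-I (`D`) solution on `(−∞,0) × ℝ³` (`ν = 1` gauge) whose
axisymmetry defect about `A e₃` is `ε`-small on `U` at every profile time vanish identically. -/
def AxiResidue (ν D : ℝ) (A : EuclideanSpace ℝ (Fin 3) ≃ₗᵢ[ℝ] EuclideanSpace ℝ (Fin 3)) : Prop :=
  ∀ (U : Set (EuclideanSpace ℝ (Fin 3))), IsOpen U → U.Nonempty → Bornology.IsBounded U →
    ∃ ε : ℝ, 0 < ε ∧
      ∀ (u : ℝ → EuclideanSpace ℝ (Fin 3) → EuclideanSpace ℝ (Fin 3)) (p : ℝ → EuclideanSpace ℝ (Fin 3) → ℝ),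
      IsClassicalNSSolutionOn (Set.Iio 0) 1 0 u p → HasTypeIDecay D u → HasSmallAxiDefectOn ν A ε U u →
      ∀ t < 0, ∀ x, u t x = 0

/-- crux (rank 2) · K-axi · **`ε`-STABILITY OF THE AXISYMMETRIC TYPE-I LIOUVILLE THEOREM** (PROVED below,
`axiStability_holds`): every axis is an `ε`-stable stratum at every viscosity and every positive decay constant. -/
def AxiStability : Prop :=
  ∀ (ν D : ℝ) (A : EuclideanSpace ℝ (Fin 3) ≃ₗᵢ[ℝ] EuclideanSpace ℝ (Fin 3)), 0 < ν → 0 < D → AxiResidue ν D A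

/-- target (rank 0) · DOOR T-axi «no ε-AXISYMMETRIC Type-I blow-up» at constants `ν, M` and axis direction `A e₃`: for every
bounded open nonempty window `U` some `ε > 0` (depending on `ν, M, A, U` only) makes «space–time local Type I with constant
`M` at `(x₀,T)` + axisymmetry defect about `x₀ + ℝ·A e₃` eventually `ε`-small on `U`» impossible at a singular point. -/
def TargetEpsAxisymAt (ν M : ℝ) (A : EuclideanSpace ℝ (Fin 3) ≃ₗᵢ[ℝ] EuclideanSpace ℝ (Fin 3)) : Prop :=
  ∀ (U : Set (EuclideanSpace ℝ (Fin 3))), IsOpen U → U.Nonempty → Bornology.IsBounded U →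
    ∃ ε : ℝ, 0 < ε ∧ ∀ (T : ℝ), 0 < T →
      ∀ (u : ℝ → EuclideanSpace ℝ (Fin 3) → EuclideanSpace ℝ (Fin 3)) (p : ℝ → EuclideanSpace ℝ (Fin 3) → ℝ),
      IsClassicalNSSolutionOn (Set.Ico 0 T) ν 0 u p → IsLerayHopfOn T ν 0 (u 0) u → HasRapidSpatialDecay (u 0) →
      ∀ (x₀ : EuclideanSpace ℝ (Fin 3)) (ρ : ℝ), 0 < ρ →
      (∀ t ∈ Set.Ico 0 T, T - ρ ^ 2 < t → ∀ x ∈ Metric.ball x₀ ρ, ‖u t x‖ * (‖x - x₀‖ + Real.sqrt (ν * (T - t))) ≤ M) →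
      AxiDefectEventuallySmall T x₀ u A U ε → IsBackwardBoundedAt u T x₀

/-- target (rank 0) · DOOR T-axi for all constants and all axes. -/
def TargetEpsAxisym : Prop :=
  ∀ (ν M : ℝ) (A : EuclideanSpace ℝ (Fin 3) ≃ₗᵢ[ℝ] EuclideanSpace ℝ (Fin 3)), 0 < ν → TargetEpsAxisymAt ν M A

/-- assembly (rank 1) · K1-axi → K-axi → door T-axi. -/
def AssemblyAxi : Prop := LocalPointZoomAxiDefect → AxiStability → TargetEpsAxisym

/-! ## §2 Proved logic: the door from K1-axi and K-axi -/

/-- a profile with nonpositive decay constant vanishes. -/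
theorem eq_zero_of_decay_nonpos {D : ℝ} (hD : D ≤ 0) {v : ℝ → EuclideanSpace ℝ (Fin 3) → EuclideanSpace ℝ (Fin 3)}
    (hdec : HasTypeIDecay D v) : ∀ s < 0, ∀ z, v s z = 0 := by
  intro s hs z
  have hsq : 0 < Real.sqrt (-s) := Real.sqrt_pos.2 (by linarith)
  have hden : 0 < ‖z‖ + Real.sqrt (-s) := by positivity
  have hle : ‖v s z‖ ≤ 0 := (hdec s hs z).trans (div_nonpos_iff.2 (Or.inr ⟨hD, hden.le⟩))
  exact norm_le_zero_iff.1 hle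

/-- **The door at fixed constants from K1-axi and the residue R-axi** (PROVED). -/
theorem targetEpsAxisymAt_of_residue {ν M : ℝ} (hν : 0 < ν) {A : EuclideanSpace ℝ (Fin 3) ≃ₗᵢ[ℝ] EuclideanSpace ℝ (Fin 3)}
    (h₁ : LocalPointZoomAxiDefect) (h₂ : 0 < M / ν → AxiResidue ν (M / ν) A) : TargetEpsAxisymAt ν M A := by
  intro U hU hne hbdd
  rcases le_or_gt (M / ν) 0 with hD | hD
  · refine ⟨1, one_pos, fun T hT u p hcl hLH hdec x₀ ρ hρ hM _ => ?_⟩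
    by_contra hnot
    obtain ⟨C, v, _, hdecay, hsing, _⟩ := h₁ ν T hν hT u p hcl hLH hdec x₀ ρ M hρ hM hnot
    exact not_isBackwardSingularPoint_of_eq_zero (eq_zero_of_decay_nonpos hD hdecay) hsing
  · obtain ⟨ε, hε, hres⟩ := h₂ hD U hU hne hbdd
    refine ⟨ε, hε, fun T hT u p hcl hLH hdec x₀ ρ hρ hM hsmall => ?_⟩
    by_contra hnot
    obtain ⟨C, v, hcls, hdecay, hsing, hax⟩ := h₁ ν T hν hT u p hcl hLH hdec x₀ ρ M hρ hM hnot
    obtain ⟨hrate, hcont, hmild, hdiv⟩ := hcls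
    have hmildcls : IsTypeIAncientMild C v := isTypeIAncientMild_of_class hrate hcont hmild hdiv
    obtain ⟨q, hclv⟩ :=
      Summit.NavierStokesRegularity.NavierStokesRegularity.Theorems.exists_isClassicalNSSolutionOn_Iio_of_isTypeIAncientMild
        hmildcls
    exact not_isBackwardSingularPoint_of_eq_zero (hres v q hclv hdecay (hax A U ε hsmall)) hsing

/-- **`closes`-style deciding logic of S26 (PROVED):** K1-axi → K-axi → door T-axi. -/
theorem assemblyAxi_holds : AssemblyAxi := fun h₁ h₂ ν M A hν =>
  targetEpsAxisymAt_of_residue hν h₁ fun hD => h₂ ν (M / ν) A hν hD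

end Summit.NavierStokesRegularity.NavierStokesRegularity.Theorems.StableStrataDoorDefs
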